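import Summits.QuantumFields.BalabanUV.Beta.MultiscaleHessianCells
import Summits.QuantumFields.BalabanUV.Beta.MultiscaleHessianCommutator

/-!
# `Summit.QuantumFields.BalabanUV.Beta.MultiscaleHessianL2` — engine file 22f: THE PURE SECOND-ORDER ℓ² MEMBER (3.46)₄'s SHAPE for the
# MODEL operator `levelOp` with FLAT transport and CONSTANT bond weight — `‖1_{cell k}∇∇(levelOp)⁻¹u‖₂ ≤ K_H·e^{(κ−log L/R)(4d+ρ₀)}·
# e^{−(κ−log L/R)d_n(t_k,t_{k′})}·‖u‖₂` for `u` supported in cell `k′`, with NO power of the local scale (print's «1») — the END of the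
# programme «HESSIAN-L2-FLAT» (files 22a identity, 22b C² cutoff, 22c commutator, 22d geometry, 22e cell inputs)

HONEST FRAMING (page 1 of everything in this cell).  Discharging `FlowStep.BetaPertH` would make Bałaban's ultraviolet
stability UNCONDITIONAL — a constructive-QFT result; it is NOT the continuum limit and NOT the Clay problem.  This module
discharges nothing of `BetaPertH`; it is [folklore] finite-dimensional bookkeeping about the MODEL operator, kernel-checked, by the
OWNER of binder row D4 (unit `b2b-balaban-beta-an4`, gen 47).  HONEST DEPENDENCY: continuum YM on T⁴ ⇐ BetaPertH ∧ nine spine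
estimates (0/9 proved); BetaPertH ⇐ (D1) ∧ (D4) ∧ CAP+tail; G-an2-4 gates asym, D1 and NE2/3/4.

THE POINT (O.2 item (i), MODEL level; NOT the critical path).  [B9] Thm 3.1 (3.46) p. 398 (render `g46/renders/b9-p010-s4.png`, read as
image): «‖hG′(U)λ‖, ‖h∇_UG′(U)λ‖, ‖hG′(U)∇*_Uλ‖, ‖h∇_U∇_UG′(U)λ‖, ‖h∇_UG′(U)∇*_Uλ‖, ‖hG′(U)∇*_U∇*_Uλ‖ ≤ B₀[(L^jη)², L^jη, L^jη, 1, 1, 1]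
|h|e^{−δ₀d(y,y′)}‖λ‖ for supp h ⊂ Δ(y), y ∈ Λ_j, supp λ ⊂ Δ(y′)».  Census E-an4-141e: members 1, 2, 3, 5 KERNEL for every isometric
transport; 4 and 6 (pure second order) OPEN — «flat needs a C² cutoff».  THIS FILE closes member 4 for the MODEL with FLAT transport
and constant bond weight: **`real_cellHess_levelOp_inverse_le`** —
`√(Σ_{x ∈ cell k}Σ_{μ,ν,i}((D(levelOp)⁻¹u)((x+e_ν,μ),i) − (D(levelOp)⁻¹u)((x,μ),i))²) ≤ K_H·E·√(Σ_{cell k′}u²)`,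
`E = e^{(κ−log L/R)(4d+ρ₀)}·e^{−(κ−log L/R)d_n(t_k,t_{k′})}`, `K_H` seeing `d, c₀, c_max, a_max, C, μ₀, κ, |Cp|, L, A, R, ρ₀, ε` only
— NO power of `S_k` or `S_{k′}`.  Assembly: 22c's `cell_hessian_le_of_cutoff` with 22b's `boxCutoff (cellMid k) (S_k/2 + 2) S_k`
(`θ₁ = 1/S_k`, `θ₂ = 2/S_k²`; `χ = 1` on the cell's 2-neighbourhood by 22d's `dist_le_of_cellOf_eq`) ⟹ `c₀²·Hess ≤ 3‖1_UD*Dw‖² +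
12d²c₀⁴S_k^{−4}‖1_Uw‖² + 12dc₀²S_k^{−2}‖1_UDw‖²` on the box `U` of radius `S_k/2 + 2S_k + 5 ≤ 8S_k`; 22d covers `U` by the near cells
(`d_n(t_{k″},t_k) ≤ 4d + ρ₀`, under the ONE rate-type hypothesis `hρ₀ : 8·d·L^A·e^{(log L/R)ρ₀} ≤ ρ₀`, `ρ₀ ∈ ℕ` free) and counts them;
22e bounds the three quantities on each near cell by `E²‖u‖²` times `[K_Δ, K_w·S_k⁴, K_∇·S_k²]` — the powers of `S_k` CANCEL EXACTLY
against `S_k^{−4}`, `S_k^{−2}`.  Member 6 follows by transposition (file 22g, 20d's pattern).  WHAT THIS IS NOT: nothing of Bałaban's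
∇_U∇_UG′(U); flat transport only (for rough transports the identity of 22a carries curvature — (3.35)); row D4 readiness width 0;
D4 DISCHARGE NO DATE.

WHAT IS CERTIFIED (kernel, 0 sorry, 0 def): `sum_le_card_mul`, **`real_cellHess_levelOp_inverse_le`**.  LOCATORS (shape only; ABSOLUTE
RULE — nothing printed is asserted): [Balaban1985BackgroundPropagators] Thm 3.1 (3.46) p. 398, (3.3) p. 391; [Balaban1984PropagatorsII]
Lemma 2.1 (2.61) p. 234, (2.46) p. 231.  NOT BetaPertH, NOT continuum, NOT Clay, NOT summit progress.
-/

open scoped BigOperators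
open Finset

namespace Summit.QuantumFields.BalabanUV.Beta.MultiscaleHessianL2

open Summit.QuantumFields.BalabanUV.Beta.MultiscaleHessianCells (cell_sq_norm_le_near cell_sq_grad_le_near cell_sq_lap_le_near)
open Summit.QuantumFields.BalabanUV.Beta.MultiscaleHessianCommutator (cell_hessian_le_of_cutoff)
open Summit.QuantumFields.BalabanUV.Beta.MultiscaleHessianCutoff (boxCutoff boxCutoff_nonneg boxCutoff_le_one boxCutoff_eq_one
  dist_le_of_boxCutoff_ne_zero abs_boxCutoff_up_sub_le abs_boxCutoff_second_le)
open Summit.QuantumFields.BalabanUV.Beta.MultiscaleHessianGeometry (cellMid dist_le_of_cellOf_eq sdist_centres_le_of_box card_near_le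
  sum_box_le_sum_cells_site sum_box_le_sum_cells_bond)
open Summit.QuantumFields.BalabanUV.Beta.BoxPoincare (Box)
open Summit.QuantumFields.BalabanUV.Beta.MultiscaleCoerciveTorus
open Summit.QuantumFields.BalabanUV.Beta.MultiscaleDistance
open Summit.QuantumFields.BalabanUV.Beta.MultiscaleDecayBudget
open Literature.MathematicalPhysics.QuantumFieldTheory.Balaban1983to89
open Literature.MathematicalPhysics.QuantumFieldTheory.Balaban1983to89.B9Thm37Glue (covD covDT)
open Literature.MathematicalPhysics.QuantumFieldTheory.Balaban1983to89.B9Thm37GluePU (bsrc btgt)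
open Literature.MathematicalPhysics.QuantumFieldTheory.Balaban1983to89.B9Thm37GlueTorusCov (tblk)
open Literature.MathematicalPhysics.QuantumFieldTheory.Balaban1983to89.B9Thm37GlueTorusCovLevels (levelOp)
open B5TorusCover (UT Ctr ctrU)
open B5Leibniz121 (up dn)

noncomputable section

/-- A finite sum of terms each `≤ M` (`M ≥ 0`) over a set of cardinality `≤ Z` is `≤ Z·M`. [folklore] -/
theorem sum_le_card_mul {ι : Type*} (s : Finset ι) (f : ι → ℝ) {M Z : ℝ} (hM : 0 ≤ M) (hf : ∀ i ∈ s, f i ≤ M) (hZ : (s.card : ℝ) ≤ Z) :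
    ∑ i ∈ s, f i ≤ Z * M :=
  (Finset.sum_le_sum hf).trans (by rw [Finset.sum_const, nsmul_eq_mul]; exact mul_le_mul_of_nonneg_right hZ hM)

variable {d : ℕ} {N : Fin d → ℕ} [∀ i, NeZero (N i)] [NeZero d] {Cp J K : Type} [Fintype Cp] [DecidableEq Cp] [Nonempty Cp]
  [Fintype J] [Fintype K] [DecidableEq K] (S : J → ℕ) (hS : ∀ l, 1 ≤ S l) (hdivS : ∀ l i, S l ∣ N i) (lvl : K → J)
  (zc : (k : K) → Ctr N (S (lvl k)))
  (hdisj : ∀ k k' v v', cellPt S hS hdivS lvl zc k v = cellPt S hS hdivS lvl zc k' v' → k = k')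
  (hcover : ∀ x : UT N, ∃ k, ∃ v : Box d (S (lvl k)), cellPt S hS hdivS lvl zc k v = x)
  (Rm : UT N × Fin d → Cp → Cp → ℝ) (hRm : ∀ b i j, ∑ k, Rm b k i * Rm b k j = if i = j then (1 : ℝ) else 0)
  (T : J → UT N → Cp → Cp → ℝ) (hT : ∀ l x i i', ∑ k, T l x k i * T l x k i' = if i = i' then (1 : ℝ) else 0)
  (a : J → ℝ) (ha : ∀ j, 0 ≤ a j) (ω : J → UT N → ℝ)
  (hsupp : ∀ l x, ω l (ctrU N (S l) (tblk (hS l) (hdivS l) x)) ≠ 0 → ∃ k v, lvl k = l ∧ cellPt S hS hdivS lvl zc k v = x)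
  {amax : ℝ} (hamax : 0 ≤ amax)
  (hscale : ∀ k, a (lvl k) * ω (lvl k) (ctrU N (S (lvl k)) (zc k)) ^ 2 * (S (lvl k) : ℝ) ^ d ≤ amax / (S (lvl k) : ℝ) ^ 2)
  (c : UT N × Fin d → ℝ) {cmax : ℝ} (hc : ∀ b, |c b| ≤ cmax) {C : ℝ}
  (hcoer : ∀ f : UT N × Cp → ℝ,
    C * ∑ k, ((S (lvl k) : ℝ) ^ 2)⁻¹ * ∑ v : Box d (S (lvl k)), ∑ i, f (cellPt S hS hdivS lvl zc k v, i) ^ 2 ≤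
      ∑ p, f p * levelOp bsrc btgt c Rm (fun l x => ctrU N (S l) (tblk (hS l) (hdivS l) x))
        (fun l x => ω l (ctrU N (S l) (tblk (hS l) (hdivS l) x))) T a f p)
  {κ : ℝ} (hκ0 : 0 ≤ κ) (hκ1 : κ ≤ 1) (hμ : 0 < C - 2 * d * cmax ^ 2 * κ ^ 2 - amax * (Real.exp (2 * d * κ) - 1))
  {L : ℕ} (hL : 1 ≤ L) (e : J → ℕ) (hSe : ∀ l, S l = L ^ e l) {R : ℝ} (hR : 0 < R) {A : ℕ}
  (hadd : ∀ x y : UT N, |(e (lvl (cellOf S hS hdivS lvl zc hcover x)) : ℝ) - e (lvl (cellOf S hS hdivS lvl zc hcover y))| ≤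
    A + sdist bsrc btgt (siteScale S hS hdivS lvl zc hcover) x y / R)
  (hrate1 : Real.log L / R ≤ κ)
  (hflat : ∀ b k i, Rm b k i = if k = i then 1 else 0) {c₀ : ℝ} (hcc : ∀ b, c b = c₀) (hc₀ : c₀ ≠ 0)

include hdisj hRm hT ha hsupp hamax hscale hc hcoer hκ0 hκ1 hμ hL hSe hR hadd hrate1 hflat hcc hc₀

/-- **THE PURE SECOND-ORDER ℓ² MEMBER (3.46)₄'s SHAPE FOR `levelOp` — FLAT TRANSPORT, CONSTANT WEIGHT, NO POWER OF THE SCALE.**  In the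
MODEL setting of `MultiscaleDecay.hc_levelOp` (isometric `T`, (P) budget, cell-sum coercivity `C`, margin `μ₀ > 0`) with FLAT transport
`Rm ≡ 1`, constant bond weight `c ≡ c₀ ≠ 0`, graded sides `S_l = L^{e_l}` with the sitewise additive datum, `log L/R ≤ κ`, a natural
`ρ₀` with `8·d·L^A·e^{(log L/R)ρ₀} ≤ ρ₀` and a free `ε > 0`: for `u` supported in cell `k′` and every cell `k`,
`√(Σ_{x ∈ cell k}Σ_μΣ_νΣ_i((D w)((x+e_ν,μ),i) − (D w)((x,μ),i))²) ≤ √(N_cnt·K_tot/c₀²)·e^{(κ−log L/R)(4d+ρ₀)}·e^{−(κ−log L/R)d_n(t_k,t_{k′})}·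
√(Σ_{cell k′}u²)`, `w = (levelOp)⁻¹u`, with `N_cnt = (3(L^A)²)^d(d!/ε^d)e^{2d(ε+(log L/R)d)}·(e^{ε+2(log L/R)d})^{4d+ρ₀+1}` (growth) and
`K_tot = 6(1 + |Cp|a_max²(L^Ae^{4dκ}/μ₀)²) + 12d²c₀⁴(L^Ae^{4dκ}Γ₄²/μ₀)² + 12dc₀²·2(C+de²c_max²)(L^AΓ₄e^{4dκ}/μ₀)²`, `Γ₄ = L^Ae^{(log L/R)(4d+ρ₀)}`.
[cite: Balaban1985BackgroundPropagators, Thm 3.1 (3.46) p.398; Balaban1984PropagatorsII, Lemma 2.1 (2.61) p.234 + (2.46) p.231] [folklore] -/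
theorem real_cellHess_levelOp_inverse_le (ρ₀ : ℕ) (hρ₀ : 8 * d * ((L : ℝ) ^ A * Real.exp (Real.log L / R * ρ₀)) ≤ ρ₀) {ε : ℝ} (hε : 0 < ε)
    (k' : K) (u : UT N × Cp → ℝ) (hu : ∀ p, cellOf S hS hdivS lvl zc hcover p.1 ≠ k' → u p = 0) (k : K) :
    Real.sqrt (∑ x ∈ univ.filter (fun x : UT N => cellOf S hS hdivS lvl zc hcover x = k), ∑ μ : Fin d, ∑ ν : Fin d, ∑ i : Cp,
        (covD bsrc btgt c Rm ((Ring.inverse (levelOp bsrc btgt c Rm (fun l x => ctrU N (S l) (tblk (hS l) (hdivS l) x))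
            (fun l x => ω l (ctrU N (S l) (tblk (hS l) (hdivS l) x))) T a)) u) ((up x ν, μ), i) -
          covD bsrc btgt c Rm ((Ring.inverse (levelOp bsrc btgt c Rm (fun l x => ctrU N (S l) (tblk (hS l) (hdivS l) x))
            (fun l x => ω l (ctrU N (S l) (tblk (hS l) (hdivS l) x))) T a)) u) ((x, μ), i)) ^ 2) ≤
      Real.sqrt ((3 * ((L : ℝ) ^ A) ^ 2) ^ d * ((d.factorial : ℝ) / ε ^ d) * Real.exp (2 * d * (ε + Real.log L / R * d)) *
            Real.exp (ε + 2 * (Real.log L / R) * d) ^ (4 * d + ρ₀ + 1) *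
          (3 * (2 * (1 + Fintype.card Cp * amax ^ 2 * ((L : ℝ) ^ A * Real.exp (4 * d * κ) /
              (C - 2 * d * cmax ^ 2 * κ ^ 2 - amax * (Real.exp (2 * d * κ) - 1))) ^ 2)) +
            12 * d ^ 2 * c₀ ^ 4 * ((L : ℝ) ^ A * Real.exp (4 * d * κ) *
              ((L : ℝ) ^ A * Real.exp (Real.log L / R * (4 * d + ρ₀))) ^ 2 /
              (C - 2 * d * cmax ^ 2 * κ ^ 2 - amax * (Real.exp (2 * d * κ) - 1))) ^ 2 +
            12 * d * c₀ ^ 2 * (Real.sqrt (2 * (C + d * Real.exp 1 ^ 2 * cmax ^ 2)) * (L : ℝ) ^ A *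
              ((L : ℝ) ^ A * Real.exp (Real.log L / R * (4 * d + ρ₀))) /
              (C - 2 * d * cmax ^ 2 * κ ^ 2 - amax * (Real.exp (2 * d * κ) - 1)) * Real.exp (4 * d * κ)) ^ 2) / c₀ ^ 2) *
        (Real.exp ((κ - Real.log L / R) * (4 * d + ρ₀)) *
          Real.exp (-((κ - Real.log L / R) * sdist bsrc btgt (siteScale S hS hdivS lvl zc hcover)
            (ctrU N (S (lvl k)) (zc k)) (ctrU N (S (lvl k')) (zc k'))))) *
        Real.sqrt (∑ q ∈ univ.filter (fun q : UT N × Cp => cellOf S hS hdivS lvl zc hcover q.1 = k'), u q ^ 2) := by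
  classical
  -- the near-cell inputs and the geometry, BEFORE the abbreviations
  have hN := cell_sq_norm_le_near S hS hdivS lvl zc hdisj hcover Rm hRm T hT a ha ω hsupp hamax hscale c hc hcoer hκ0 hκ1 hμ hL e hSe hR
    hadd hrate1 ρ₀ k' u hu k
  have hG := cell_sq_grad_le_near S hS hdivS lvl zc hdisj hcover Rm hRm T hT a ha ω hsupp hamax hscale c hc hcoer hκ0 hκ1 hμ hL e hSe hR
    hadd hrate1 ρ₀ k' u hu k
  have hΔ := cell_sq_lap_le_near S hS hdivS lvl zc hdisj hcover Rm hRm T hT a ha ω hsupp hamax hscale c hc hcoer hκ0 hκ1 hμ hL e hSe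
    hadd hrate1 ρ₀ k' u hu k
  have hcnt := card_near_le S hS hdivS lvl zc hdisj hcover hL e hSe hR hadd k ρ₀ hε
  -- abbreviations
  set μ₀ := C - 2 * d * cmax ^ 2 * κ ^ 2 - amax * (Real.exp (2 * d * κ) - 1) with hμ₀
  set Aop := levelOp bsrc btgt c Rm (fun l x => ctrU N (S l) (tblk (hS l) (hdivS l) x))
    (fun l x => ω l (ctrU N (S l) (tblk (hS l) (hdivS l) x))) T a with hAop
  set n := siteScale S hS hdivS lvl zc hcover with hn
  set w := (Ring.inverse Aop) u with hw
  set S₀ : ℕ := S (lvl k) with hS₀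
  set x₀ : UT N := cellMid S hS hdivS lvl zc k with hx₀
  set ρ₁ : ℕ := S₀ / 2 + 2 with hρ₁
  set χ : UT N → ℝ := boxCutoff x₀ ρ₁ S₀ with hχ
  set P := univ.filter (fun x : UT N => cellOf S hS hdivS lvl zc hcover x = k) with hP
  set Near := univ.filter (fun k'' : K => sdist bsrc btgt n (ctrU N (S (lvl k'')) (zc k'')) (ctrU N (S (lvl k)) (zc k)) ≤ 4 * d + ρ₀)
    with hNear
  set E : ℝ := Real.exp ((κ - Real.log L / R) * (4 * d + ρ₀)) *
    Real.exp (-((κ - Real.log L / R) * sdist bsrc btgt n (ctrU N (S (lvl k)) (zc k)) (ctrU N (S (lvl k')) (zc k')))) with hE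
  set U2 : ℝ := ∑ q ∈ univ.filter (fun q : UT N × Cp => cellOf S hS hdivS lvl zc hcover q.1 = k'), u q ^ 2 with hU2
  set Γ₄ : ℝ := (L : ℝ) ^ A * Real.exp (Real.log L / R * (4 * d + ρ₀)) with hΓ₄
  set KΔ : ℝ := 2 * (1 + Fintype.card Cp * amax ^ 2 * ((L : ℝ) ^ A * Real.exp (4 * d * κ) / μ₀) ^ 2) with hKΔ
  set Bw : ℝ := (L : ℝ) ^ A * Real.exp (4 * d * κ) * Γ₄ ^ 2 / μ₀ with hBw
  set Bg : ℝ := Real.sqrt (2 * (C + d * Real.exp 1 ^ 2 * cmax ^ 2)) * (L : ℝ) ^ A * Γ₄ / μ₀ * Real.exp (4 * d * κ) with hBg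
  set Ncnt : ℝ := (3 * ((L : ℝ) ^ A) ^ 2) ^ d * ((d.factorial : ℝ) / ε ^ d) * Real.exp (2 * d * (ε + Real.log L / R * d)) *
    Real.exp (ε + 2 * (Real.log L / R) * d) ^ (4 * d + ρ₀ + 1) with hNcnt
  -- positivity
  have hs1 : 1 ≤ S₀ := hS (lvl k)
  have hs0 : (0 : ℝ) < S₀ := by exact_mod_cast hs1
  have hE0 : 0 ≤ E := by positivity
  have hU20 : 0 ≤ U2 := Finset.sum_nonneg fun q _ => sq_nonneg _
  have hKΔ0 : 0 ≤ KΔ := by positivity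
  have hNcnt0 : 0 ≤ Ncnt := by positivity
  have hc2 : (0 : ℝ) < c₀ ^ 2 := by positivity
  clear_value E U2 Γ₄ KΔ Bw Bg Ncnt
  -- (1) the cutoff's properties (file 22b)
  have hχ1 : ∀ y, |χ y| ≤ 1 := fun y => by
    rw [hχ, abs_of_nonneg (boxCutoff_nonneg x₀ ρ₁ S₀ y)]; exact boxCutoff_le_one x₀ ρ₁ hs1 y
  have hχd : ∀ y μ, |χ (up y μ) - χ y| ≤ 1 / (S₀ : ℝ) := fun y μ => abs_boxCutoff_up_sub_le x₀ ρ₁ hs1 μ y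
  have hχdd : ∀ y μ, |χ (up y μ) - 2 * χ y + χ (dn y μ)| ≤ 2 / (S₀ : ℝ) ^ 2 := fun y μ => abs_boxCutoff_second_le x₀ ρ₁ hs1 μ y
  have hone : ∀ y, dist y x₀ ≤ ((ρ₁ : ℕ) : ℝ) → χ y = 1 := fun y hy => boxCutoff_eq_one x₀ ρ₁ hs1 hy
  have hsuppχ : ∀ y, χ y ≠ 0 → dist y x₀ ≤ ((ρ₁ + 2 * S₀ + 1 : ℕ) : ℝ) := fun y hy => dist_le_of_boxCutoff_ne_zero x₀ ρ₁ hs1 hy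
  have hPin : ∀ x ∈ P, dist x x₀ + 2 ≤ ((ρ₁ : ℕ) : ℝ) := fun x hx => by
    have h := dist_le_of_cellOf_eq S hS hdivS lvl zc hcover k (mem_filter.mp hx).2
    rw [← hx₀, ← hS₀] at h
    rw [hρ₁]; push_cast; linarith
  -- (2) file 22c: the localised Hessian energy
  have h22c := cell_hessian_le_of_cutoff hflat hcc χ (θ₁ := 1 / (S₀ : ℝ)) (θ₂ := 2 / (S₀ : ℝ) ^ 2) (by positivity) hχ1 hχd hχdd
    hone hsuppχ w P hPin
  -- (3) the box of radius `r + 2` is covered by the near cells (file 22d)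
  have hr2 : S₀ / 2 + 2 + 2 * S₀ + 1 + 2 ≤ 8 * S (lvl k) := by rw [← hS₀]; omega
  have hBT : ∀ y ∈ univ.filter (fun y : UT N => dist y x₀ ≤ ((ρ₁ + 2 * S₀ + 1 : ℕ) : ℝ) + 2), cellOf S hS hdivS lvl zc hcover y ∈ Near := by
    intro y hy
    rw [hNear, mem_filter]
    refine ⟨mem_univ _, ?_⟩
    have hy' : dist y (cellMid S hS hdivS lvl zc k) ≤ ((S₀ / 2 + 2 + 2 * S₀ + 1 + 2 : ℕ) : ℝ) := by
      have := (mem_filter.mp hy).2; rw [hx₀, hρ₁] at this; push_cast at this ⊢; linarith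
    have h := sdist_centres_le_of_box S hS hdivS lvl zc hdisj hcover hL e hSe hR hadd k hρ₀ hr2 hy'
    rwa [← hn] at h
  have hA1 := sum_box_le_sum_cells_site S hS hdivS lvl zc hcover _ Near hBT (fun p => (covDT bsrc btgt c Rm (covD bsrc btgt c Rm w) p) ^ 2)
    fun p => sq_nonneg _
  have hA2 := sum_box_le_sum_cells_site S hS hdivS lvl zc hcover _ Near hBT (fun p => w p ^ 2) fun p => sq_nonneg _
  have hA3 := sum_box_le_sum_cells_bond S hS hdivS lvl zc hcover _ Near hBT (fun q => (covD bsrc btgt c Rm w q) ^ 2) fun q => sq_nonneg _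
  -- (4) the near-cell inputs summed over `Near` (file 22e + the count)
  have hcnt' : (Near.card : ℝ) ≤ Ncnt := by simpa only [hNear, hn, hNcnt] using hcnt
  have hS1 : ∑ k'' ∈ Near, ∑ p ∈ univ.filter (fun p : UT N × Cp => cellOf S hS hdivS lvl zc hcover p.1 = k''),
      (covDT bsrc btgt c Rm (covD bsrc btgt c Rm w) p) ^ 2 ≤ Ncnt * (KΔ * E ^ 2 * U2) := by
    refine sum_le_card_mul Near _ (by positivity) (fun k'' hk'' => ?_) hcnt'
    exact hΔ k'' (mem_filter.mp hk'').2
  have hS2 : ∑ k'' ∈ Near, ∑ p ∈ univ.filter (fun p : UT N × Cp => cellOf S hS hdivS lvl zc hcover p.1 = k''), w p ^ 2 ≤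
      Ncnt * ((Bw * (S₀ : ℝ) ^ 2) ^ 2 * E ^ 2 * U2) := by
    refine sum_le_card_mul Near _ (by positivity) (fun k'' hk'' => ?_) hcnt'
    have h := hN k'' (mem_filter.mp hk'').2
    rw [← hS₀] at h
    calc _ ≤ _ := h
      _ = (Bw * (S₀ : ℝ) ^ 2) ^ 2 * E ^ 2 * U2 := by rw [hBw]; ring
  have hS3 : ∑ k'' ∈ Near, ∑ b ∈ univ.filter (fun b : UT N × Fin d => cellOf S hS hdivS lvl zc hcover (bsrc b) = k''),
      ∑ i, (covD bsrc btgt c Rm w (b, i)) ^ 2 ≤ Ncnt * ((Bg * (S₀ : ℝ)) ^ 2 * E ^ 2 * U2) := by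
    refine sum_le_card_mul Near _ (by positivity) (fun k'' hk'' => ?_) hcnt'
    have h := hG k'' (mem_filter.mp hk'').2
    rw [← hS₀] at h
    calc _ ≤ _ := h
      _ = (Bg * (S₀ : ℝ)) ^ 2 * E ^ 2 * U2 := by rw [hBg]; ring
  -- (5) combine: the powers of `S₀` cancel
  set H : ℝ := ∑ x ∈ P, ∑ μ : Fin d, ∑ ν : Fin d, ∑ i : Cp,
    (covD bsrc btgt c Rm w ((up x ν, μ), i) - covD bsrc btgt c Rm w ((x, μ), i)) ^ 2 with hH
  clear_value H
  have hq : (S₀ : ℝ) * (S₀ : ℝ)⁻¹ - 1 = 0 := by rw [mul_inv_cancel₀ hs0.ne', sub_self]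
  have e2 : 3 * d ^ 2 * c₀ ^ 4 * (2 / (S₀ : ℝ) ^ 2) ^ 2 * (Ncnt * ((Bw * (S₀ : ℝ) ^ 2) ^ 2 * E ^ 2 * U2)) =
      12 * d ^ 2 * c₀ ^ 4 * Bw ^ 2 * (Ncnt * E ^ 2 * U2) := by
    rw [div_eq_mul_inv, ← inv_pow]
    linear_combination (12 * d ^ 2 * c₀ ^ 4 * Bw ^ 2 * Ncnt * E ^ 2 * U2) *
      (((S₀ : ℝ) * (S₀ : ℝ)⁻¹) ^ 3 + ((S₀ : ℝ) * (S₀ : ℝ)⁻¹) ^ 2 + (S₀ : ℝ) * (S₀ : ℝ)⁻¹ + 1) * hq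
  have e3 : 12 * d * c₀ ^ 2 * (1 / (S₀ : ℝ)) ^ 2 * (Ncnt * ((Bg * (S₀ : ℝ)) ^ 2 * E ^ 2 * U2)) =
      12 * d * c₀ ^ 2 * Bg ^ 2 * (Ncnt * E ^ 2 * U2) := by
    rw [one_div]
    linear_combination (12 * d * c₀ ^ 2 * Bg ^ 2 * Ncnt * E ^ 2 * U2) * ((S₀ : ℝ) * (S₀ : ℝ)⁻¹ + 1) * hq
  have k2 : 0 ≤ 3 * d ^ 2 * c₀ ^ 4 * (2 / (S₀ : ℝ) ^ 2) ^ 2 := by positivity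
  have k3 : 0 ≤ 12 * d * c₀ ^ 2 * (1 / (S₀ : ℝ)) ^ 2 := by positivity
  have m1 := hA1.trans hS1
  have m2 := mul_le_mul_of_nonneg_left (hA2.trans hS2) k2
  have m3 := mul_le_mul_of_nonneg_left (hA3.trans hS3) k3
  rw [e2] at m2
  rw [e3] at m3
  have h0 : c₀ ^ 2 * H ≤ _ := h22c
  have hcomb : c₀ ^ 2 * H ≤ (Ncnt * (3 * KΔ + 12 * d ^ 2 * c₀ ^ 4 * Bw ^ 2 + 12 * d * c₀ ^ 2 * Bg ^ 2)) * (E ^ 2 * U2) := by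
    linarith [h0, m1, m2, m3]
  -- (6) divide by `c₀²` and take square roots
  have hK0 : 0 ≤ Ncnt * (3 * KΔ + 12 * d ^ 2 * c₀ ^ 4 * Bw ^ 2 + 12 * d * c₀ ^ 2 * Bg ^ 2) / c₀ ^ 2 := by positivity
  have hHle : H ≤ Ncnt * (3 * KΔ + 12 * d ^ 2 * c₀ ^ 4 * Bw ^ 2 + 12 * d * c₀ ^ 2 * Bg ^ 2) / c₀ ^ 2 * (E ^ 2 * U2) := by
    rw [div_mul_eq_mul_div, le_div_iff₀ hc2]
    linarith
  have e1 := Real.sq_sqrt hK0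
  have e2' := Real.sq_sqrt hU20
  have e : Ncnt * (3 * KΔ + 12 * d ^ 2 * c₀ ^ 4 * Bw ^ 2 + 12 * d * c₀ ^ 2 * Bg ^ 2) / c₀ ^ 2 * (E ^ 2 * U2) =
      (Real.sqrt (Ncnt * (3 * KΔ + 12 * d ^ 2 * c₀ ^ 4 * Bw ^ 2 + 12 * d * c₀ ^ 2 * Bg ^ 2) / c₀ ^ 2) * E * Real.sqrt U2) ^ 2 := by
    linear_combination (-(E ^ 2 * Real.sqrt U2 ^ 2)) * e1 -
      (Ncnt * (3 * KΔ + 12 * d ^ 2 * c₀ ^ 4 * Bw ^ 2 + 12 * d * c₀ ^ 2 * Bg ^ 2) / c₀ ^ 2 * E ^ 2) * e2'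
  have hrhs0 : 0 ≤ Real.sqrt (Ncnt * (3 * KΔ + 12 * d ^ 2 * c₀ ^ 4 * Bw ^ 2 + 12 * d * c₀ ^ 2 * Bg ^ 2) / c₀ ^ 2) * E * Real.sqrt U2 := by
    positivity
  calc Real.sqrt H ≤ Real.sqrt ((Real.sqrt (Ncnt * (3 * KΔ + 12 * d ^ 2 * c₀ ^ 4 * Bw ^ 2 + 12 * d * c₀ ^ 2 * Bg ^ 2) / c₀ ^ 2) * E *
        Real.sqrt U2) ^ 2) := Real.sqrt_le_sqrt (hHle.trans (le_of_eq e))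
    _ = _ := Real.sqrt_sq hrhs0

end

end Summit.QuantumFields.BalabanUV.Beta.MultiscaleHessianL2
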